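/-
HONEST FRAMING (page 1): per-curve certified theorems and census instruments; no claim on BSD in
rank ≥ 2.

# Rank-2 observatory, rank-3 arm — THE SEMISTABLE ROWS: every exceptional prime named (KCI row 72)

Zero-kit, zero-data join of row 71 (the small-prime atlas `ontoIdxB p i`, `p ≤ 13`), row 60
(`E[p]` irreducible at every Mazur prime `p ≥ 7`, every row; onto for semistable rows, Serre 1972 §5.4
Prop. 21 via row 53) and row 52 (the semistability test `Rank3Row.semistableB`, `4 595` rows).
WHAT IS CERTIFIED, for every SEMISTABLE row `r = rank3Table[i]` (`h : rank3Table[i]? = some r`,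
`hs : r.semistableB = true`):
* HYPOTHESIS-FREE, at each of Mazur's twelve primes `p ∈ {2, 3, 5, 7, 11, 13, 17, 19, 37, 43, 67, 163}`:
  `ρ̄_{E_r,p}` is onto `GL₂(𝔽_p)` iff (`p ≤ 5 ⇒ ontoIdxB p i`)
  (`Rank3Row.hasSurjectiveModNGaloisRep_iff_of_semistableB`); and `ρ̄_{E_r,5}` is onto for EVERY
  semistable row (`Rank3Row.hasSurjectiveModNGaloisRep_five_of_semistableB`: the thirteen rows that fail
  at `5` — six `E[5]`-reducible, six CM, `133956a1` — are not semistable, one kernel check), so a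
  non-surjective Mazur prime of a semistable row is `2` or `3`
  (`Rank3Row.eq_two_or_three_of_not_surjective_of_semistableB`);
* GRANTING MAZUR 1978 Thm 1 BY NAME (`mazur_isogeny_irreducible`, the tree's named fact: no rational
  `p`-isogeny outside his twelve primes), the same at EVERY prime
  (`Rank3Row.hasSurjectiveModNGaloisRep_iff_of_semistableB_of_mazur`): the exceptional primes of a
  semistable rank-3 census curve are EXACTLY the `p ∈ {2, 3}` with `ontoIdxB p i = false`, and
  `ρ̄_{E_r,p}` is onto for every prime `p` iff `ontoIdxB 2 i ∧ ontoIdxB 3 i`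
  (`Rank3Row.forall_hasSurjectiveModNGaloisRep_iff_of_semistableB_of_mazur`);
* THE CENSUS (one kernel walk of the table, `ssGo_rank3Table`): of the `4 595` semistable rows exactly
  `4 309` are onto at `2`, `3` and `5` — hence at all twelve Mazur primes hypothesis-free, and at EVERY
  prime granting Mazur's theorem —, `274` are not onto at `2`, `12` are not onto at `3` (the six
  semistable `3`-isogeny pairs), none fails at `5`, and since `4 309 + 274 + 12 = 4 595` no semistable
  row fails at two primes.
Sample: `5077a1` (row `0`) is onto at every prime, granting Mazur's theorem; hypothesis-free at his twelve.
NOT CLAIMED: anything at a prime outside Mazur's list without his Thm 1; the `4 892` non-semistable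
rows beyond `p ≤ 13` (row 71) — their images at `17, 19, 37, …` may be Cartan normalisers and are not
decided here; adelic images or Serre curves (surjectivity mod every `p` is weaker than adelic index `2`);
completeness of the table; BSD.
References: J.-P. Serre, *Propriétés galoisiennes des points d'ordre fini des courbes elliptiques*,
Invent. Math. 15 (1972), §5.4 Prop. 21; B. Mazur, *Rational isogenies of prime degree*, Invent. Math.
44 (1978), Thm 1; J. E. Cremona, *Algorithms for Modular Elliptic Curves* (1997), Tables.
-/
import Summits.BirchSwinnertonDyer.BirchSwinnertonDyer.Theorems.Rank2ObservatoryRank3SmallPrimeImages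
import Summits.BirchSwinnertonDyer.BirchSwinnertonDyer.Theorems.Rank2ObservatoryRank3MazurPrimesDecided
import HarnessLib

set_option linter.dupNamespace false
set_option autoImplicit false

open Literature Literature.NumberTheory.EllipticCurves WeierstrassCurve

namespace Summit.BirchSwinnertonDyer.BirchSwinnertonDyer.Rank2Observatory

/-! ## §1 Semistable rows never fail at `5` -/

/-- the thirteen rows that are not onto at `5` (row 71: `975`, `redFive`, `cmIdx`) are not semistable
(one kernel evaluation of the test on those rows). [cite: CremonaAlgorithms1997, Tables] -/
theorem semistableB_exc_five :
    ∀ j ∈ (975 :: (redFive ++ cmIdx)), (rank3Table[j]?).map Rank3Row.semistableB = some false := by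
  decide +kernel

/-- a semistable row passes the `p = 5` test of the atlas. [cite: CremonaAlgorithms1997, Tables] -/
theorem Rank3Row.ontoIdxB_five_of_semistableB {i : ℕ} {r : Rank3Row} (h : rank3Table[i]? = some r)
    (hs : r.semistableB = true) : ontoIdxB 5 i = true := by
  have key : ∀ j ∈ (975 :: (redFive ++ cmIdx)), j ≠ i := by
    intro j hj hji
    have hx := semistableB_exc_five j hj
    rw [hji, h, Option.map_some, Option.some.injEq, hs] at hx
    exact Bool.noConfusion hx
  have hi : ¬ (i = 975 ∨ i ∈ redFive ∨ i ∈ cmIdx) := fun hm =>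
    key i (by simpa [List.mem_cons, List.mem_append] using hm) rfl
  simp only [ontoIdxB, Nat.reduceEqDiff, if_true, if_false, Bool.and_eq_true, Bool.not_eq_true',
    decide_eq_false_iff_not, bne_iff_ne, ne_eq]
  tauto

/-- **`ρ̄_{E,5}` is onto `GL₂(𝔽₅)` for EVERY semistable row**, hypothesis-free. [cite: Serre1972, §2.4 Prop. 15] -/
theorem Rank3Row.hasSurjectiveModNGaloisRep_five_of_semistableB {i : ℕ} {r : Rank3Row}
    (h : rank3Table[i]? = some r) (hs : r.semistableB = true) : r.curve.HasSurjectiveModNGaloisRep 5 := by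
  simpa using (Rank3Row.hasSurjectiveModNGaloisRep_iff_ontoIdxB h 5 (by norm_num) (by norm_num)).mpr
    (Rank3Row.ontoIdxB_five_of_semistableB h hs)

/-! ## §2 Every exceptional prime named -/

/-- **HYPOTHESIS-FREE, every semistable row, each of Mazur's twelve primes**: `ρ̄_{E,p}` onto iff
(`p ≤ 5 ⇒ ontoIdxB p i`) — the atlas at `2, 3, 5`; rows 60 + 53 (irreducible ⇒ onto, Serre's Prop. 21) at
`7 … 163`. [cite: Serre1972, §5.4 Prop. 21] [cite: Mazur1978, §6] -/
theorem Rank3Row.hasSurjectiveModNGaloisRep_iff_of_semistableB {i : ℕ} {r : Rank3Row}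
    (h : rank3Table[i]? = some r) (hs : r.semistableB = true) (p : ℕ) (hp : p.Prime)
    (hpM : p ∈ mazurPrimes) : r.curve.HasSurjectiveModNGaloisRep p ↔ (p ≤ 5 → ontoIdxB p i = true) := by
  by_cases h5 : p ≤ 5
  · rw [Rank3Row.hasSurjectiveModNGaloisRep_iff_ontoIdxB h p hp (by omega)]
    exact ⟨fun hb _ => hb, fun hb => hb h5⟩
  · haveI : Fact p.Prime := ⟨hp⟩
    have h7 : 7 ≤ p := by by_contra h7; interval_cases p; exact absurd hp (by decide)  -- `p = 6`
    exact ⟨fun _ hh => absurd hh h5, fun _ => Rank3Row.hasSurjectiveModNGaloisRep_of_mem_mazurPrimes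
      (List.mem_of_getElem? h) hs p hpM h7⟩

/-- **GRANTING MAZUR'S Thm 1 by name, every semistable row, EVERY prime**: `ρ̄_{E,p}` onto iff
(`p ≤ 5 ⇒ ontoIdxB p i`). [cite: Mazur1978, Thm 1] [cite: Serre1972, §5.4 Prop. 21] -/
theorem Rank3Row.hasSurjectiveModNGaloisRep_iff_of_semistableB_of_mazur (hM : mazur_isogeny_irreducible)
    {i : ℕ} {r : Rank3Row} (h : rank3Table[i]? = some r) (hs : r.semistableB = true) (p : ℕ)
    (hp : p.Prime) : r.curve.HasSurjectiveModNGaloisRep p ↔ (p ≤ 5 → ontoIdxB p i = true) := by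
  by_cases h5 : p ≤ 5
  · rw [Rank3Row.hasSurjectiveModNGaloisRep_iff_ontoIdxB h p hp (by omega)]
    exact ⟨fun hb _ => hb, fun hb => hb h5⟩
  · have h7 : 7 ≤ p := by by_contra h7; interval_cases p; exact absurd hp (by decide)  -- `p = 6`
    exact ⟨fun _ hh => absurd hh h5, fun _ => Rank3Row.hasSurjectiveModNGaloisRep_of_mem_of_seven_le
      (List.mem_of_getElem? h) hs hM p hp h7⟩

/-- **a non-surjective Mazur prime of a semistable row is `2` or `3`**, hypothesis-free.
[cite: Serre1972, §5.4 Prop. 21] -/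
theorem Rank3Row.eq_two_or_three_of_not_surjective_of_semistableB {i : ℕ} {r : Rank3Row}
    (h : rank3Table[i]? = some r) (hs : r.semistableB = true) {p : ℕ} (hp : p.Prime)
    (hpM : p ∈ mazurPrimes) (hn : ¬ r.curve.HasSurjectiveModNGaloisRep p) : p = 2 ∨ p = 3 := by
  rw [Rank3Row.hasSurjectiveModNGaloisRep_iff_of_semistableB h hs p hp hpM] at hn
  push Not at hn
  obtain ⟨h5, hb⟩ := hn
  obtain rfl | rfl | rfl | rfl | rfl | rfl := eq_of_prime_le_thirteen hp (by omega) <;> try omega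
  exact absurd (Rank3Row.ontoIdxB_five_of_semistableB h hs) hb

/-- **granting Mazur's Thm 1: a non-surjective prime of a semistable row is `2` or `3`.**
[cite: Mazur1978, Thm 1] [cite: Serre1972, §5.4 Prop. 21] -/
theorem Rank3Row.eq_two_or_three_of_not_surjective_of_semistableB_of_mazur
    (hM : mazur_isogeny_irreducible) {i : ℕ} {r : Rank3Row} (h : rank3Table[i]? = some r)
    (hs : r.semistableB = true) {p : ℕ} (hp : p.Prime) (hn : ¬ r.curve.HasSurjectiveModNGaloisRep p) :
    p = 2 ∨ p = 3 := by
  rw [Rank3Row.hasSurjectiveModNGaloisRep_iff_of_semistableB_of_mazur hM h hs p hp] at hn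
  push Not at hn
  obtain ⟨h5, hb⟩ := hn
  obtain rfl | rfl | rfl | rfl | rfl | rfl := eq_of_prime_le_thirteen hp (by omega) <;> try omega
  exact absurd (Rank3Row.ontoIdxB_five_of_semistableB h hs) hb

/-- row `i` passes the atlas at `2`, `3` and `5`. [folklore] -/
def ontoSmallB (i : ℕ) : Bool := ontoIdxB 2 i && ontoIdxB 3 i && ontoIdxB 5 i

/-- **GRANTING MAZUR'S Thm 1: a semistable row is onto at EVERY prime iff it passes the atlas at `2` and
`3`** (at `5` every semistable row passes). [cite: Mazur1978, Thm 1] [cite: Serre1972, §5.4 Prop. 21] -/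
theorem Rank3Row.forall_hasSurjectiveModNGaloisRep_iff_of_semistableB_of_mazur
    (hM : mazur_isogeny_irreducible) {i : ℕ} {r : Rank3Row} (h : rank3Table[i]? = some r)
    (hs : r.semistableB = true) :
    (∀ p : ℕ, p.Prime → r.curve.HasSurjectiveModNGaloisRep p) ↔ (ontoIdxB 2 i = true ∧ ontoIdxB 3 i = true) := by
  constructor
  · intro hall
    exact ⟨(Rank3Row.hasSurjectiveModNGaloisRep_iff_of_semistableB_of_mazur hM h hs 2 Nat.prime_two).mp
        (hall 2 Nat.prime_two) (by norm_num),
      (Rank3Row.hasSurjectiveModNGaloisRep_iff_of_semistableB_of_mazur hM h hs 3 Nat.prime_three).mp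
        (hall 3 Nat.prime_three) (by norm_num)⟩
  · rintro ⟨h2, h3⟩ p hp
    rw [Rank3Row.hasSurjectiveModNGaloisRep_iff_of_semistableB_of_mazur hM h hs p hp]
    intro h5
    obtain rfl | rfl | rfl | rfl | rfl | rfl := eq_of_prime_le_thirteen hp (by omega) <;>
      first | exact h2 | exact h3 | exact Rank3Row.ontoIdxB_five_of_semistableB h hs | omega

/-- **USE: one kernel Boolean gives surjectivity at EVERY prime for a semistable row, granting Mazur's
Thm 1** — `Rank3Row.hasSurjectiveModNGaloisRep_of_semistableB_of_mazur hM h hs (by decide +kernel) p hp`.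
[cite: Mazur1978, Thm 1] [cite: Serre1972, §5.4 Prop. 21] -/
theorem Rank3Row.hasSurjectiveModNGaloisRep_of_semistableB_of_mazur (hM : mazur_isogeny_irreducible)
    {i : ℕ} {r : Rank3Row} (h : rank3Table[i]? = some r) (hs : r.semistableB = true)
    (hb : ontoSmallB i = true) (p : ℕ) (hp : p.Prime) : r.curve.HasSurjectiveModNGaloisRep p := by
  simp only [ontoSmallB, Bool.and_eq_true] at hb
  exact (Rank3Row.forall_hasSurjectiveModNGaloisRep_iff_of_semistableB_of_mazur hM h hs).mpr ⟨hb.1.1, hb.1.2⟩ p hp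

/-- **USE, hypothesis-free: the same at each of Mazur's twelve primes.** [cite: Serre1972, §5.4 Prop. 21] -/
theorem Rank3Row.hasSurjectiveModNGaloisRep_of_semistableB {i : ℕ} {r : Rank3Row}
    (h : rank3Table[i]? = some r) (hs : r.semistableB = true) (hb : ontoSmallB i = true) (p : ℕ)
    (hp : p.Prime) (hpM : p ∈ mazurPrimes) : r.curve.HasSurjectiveModNGaloisRep p := by
  simp only [ontoSmallB, Bool.and_eq_true] at hb
  rw [Rank3Row.hasSurjectiveModNGaloisRep_iff_of_semistableB h hs p hp hpM]
  intro h5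
  obtain rfl | rfl | rfl | rfl | rfl | rfl := eq_of_prime_le_thirteen hp (by omega) <;>
    first | exact hb.1.1 | exact hb.1.2 | exact hb.2 | omega

/-! ## §3 The census of the semistable rows (one kernel walk) -/

/-- the row's contribution at index `i`: on a semistable row (`1` if onto at `2, 3, 5`, `1` if not onto
at `2`, `1` if not onto at `3`); `(0, 0, 0)` on a non-semistable row. [folklore] -/
def Rank3Row.ssT (r : Rank3Row) (i : ℕ) : ℕ × ℕ × ℕ :=
  if r.semistableB then ((ontoSmallB i).toNat, (!ontoIdxB 2 i).toNat, (!ontoIdxB 3 i).toNat) else (0, 0, 0)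

/-- the walk: sum of the contributions along a chunk whose first row has index `i`. [folklore] -/
def ssGo : List Rank3Row → ℕ → ℕ × ℕ × ℕ
  | [], _ => (0, 0, 0)
  | r :: rs, i => r.ssT i + ssGo rs (i + 1)

/-- `ssGo` splits along an append. [folklore] -/
theorem ssGo_append : ∀ (l₁ l₂ : List Rank3Row) (i : ℕ),
    ssGo (l₁ ++ l₂) i = ssGo l₁ i + ssGo l₂ (i + l₁.length) := by
  intro l₁
  induction l₁ with
  | nil => intro l₂ i; simp [ssGo]
  | cons r rs ih =>
    intro l₂ i
    simp only [List.cons_append, ssGo, ih, List.length_cons]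
    rw [show i + (rs.length + 1) = i + 1 + rs.length by omega]
    exact (add_assoc _ _ _).symm

/-- what the walk counts: the semistable rows of the chunk that are onto at `2, 3, 5` / not onto at `2` /
not onto at `3` (indices from `i`). [folklore] -/
theorem ssGo_eq : ∀ (l : List Rank3Row) (i : ℕ), ssGo l i =
    (((l.zipIdx i).filter fun ri => ri.1.semistableB && ontoSmallB ri.2).length,
     ((l.zipIdx i).filter fun ri => ri.1.semistableB && !ontoIdxB 2 ri.2).length,
     ((l.zipIdx i).filter fun ri => ri.1.semistableB && !ontoIdxB 3 ri.2).length) := by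
  intro l
  induction l with
  | nil => intro i; simp [ssGo]
  | cons r rs ih =>
    intro i
    rw [ssGo, ih (i + 1), List.zipIdx_cons]
    simp only [List.filter_cons, Rank3Row.ssT]
    cases r.semistableB <;> cases ontoSmallB i <;> cases ontoIdxB 2 i <;> cases ontoIdxB 3 i <;>
      simp [Prod.mk_add_mk, Nat.add_comm]

section chunks
set_option maxHeartbeats 4000000

/-- chunk `01` (rows `0 … 351`). [folklore] -/ theorem ssc01 : ssGo rank3Rows01 0 = (213, 2, 0) := by decide +kernel
/-- chunk `02` (rows `352 … 703`). [folklore] -/ theorem ssc02 : ssGo rank3Rows02 352 = (190, 8, 0) := by decide +kernel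
/-- chunk `03` (rows `704 … 1055`). [folklore] -/ theorem ssc03 : ssGo rank3Rows03 704 = (174, 8, 0) := by decide +kernel
/-- chunk `04` (rows `1056 … 1407`). [folklore] -/ theorem ssc04 : ssGo rank3Rows04 1056 = (182, 12, 0) := by decide +kernel
/-- chunk `05` (rows `1408 … 1759`). [folklore] -/ theorem ssc05 : ssGo rank3Rows05 1408 = (180, 12, 0) := by decide +kernel
/-- chunk `06` (rows `1760 … 2111`). [folklore] -/ theorem ssc06 : ssGo rank3Rows06 1760 = (181, 12, 0) := by decide +kernel
/-- chunk `07` (rows `2112 … 2463`). [folklore] -/ theorem ssc07 : ssGo rank3Rows07 2112 = (156, 10, 2) := by decide +kernel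
/-- chunk `08` (rows `2464 … 2815`). [folklore] -/ theorem ssc08 : ssGo rank3Rows08 2464 = (174, 6, 0) := by decide +kernel
/-- chunk `09` (rows `2816 … 3167`). [folklore] -/ theorem ssc09 : ssGo rank3Rows09 2816 = (158, 8, 0) := by decide +kernel
/-- chunk `10` (rows `3168 … 3519`). [folklore] -/ theorem ssc10 : ssGo rank3Rows10 3168 = (151, 10, 0) := by decide +kernel
/-- chunk `11` (rows `3520 … 3871`). [folklore] -/ theorem ssc11 : ssGo rank3Rows11 3520 = (167, 10, 2) := by decide +kernel
/-- chunk `12` (rows `3872 … 4223`). [folklore] -/ theorem ssc12 : ssGo rank3Rows12 3872 = (184, 12, 4) := by decide +kernel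
/-- chunk `13` (rows `4224 … 4575`). [folklore] -/ theorem ssc13 : ssGo rank3Rows13 4224 = (143, 10, 0) := by decide +kernel
/-- chunk `14` (rows `4576 … 4927`). [folklore] -/ theorem ssc14 : ssGo rank3Rows14 4576 = (136, 12, 0) := by decide +kernel
/-- chunk `15` (rows `4928 … 5279`). [folklore] -/ theorem ssc15 : ssGo rank3Rows15 4928 = (160, 14, 0) := by decide +kernel
/-- chunk `16` (rows `5280 … 5631`). [folklore] -/ theorem ssc16 : ssGo rank3Rows16 5280 = (151, 12, 0) := by decide +kernel
/-- chunk `17` (rows `5632 … 5983`). [folklore] -/ theorem ssc17 : ssGo rank3Rows17 5632 = (148, 4, 0) := by decide +kernel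
/-- chunk `18` (rows `5984 … 6335`). [folklore] -/ theorem ssc18 : ssGo rank3Rows18 5984 = (152, 10, 0) := by decide +kernel
/-- chunk `19` (rows `6336 … 6687`). [folklore] -/ theorem ssc19 : ssGo rank3Rows19 6336 = (139, 12, 0) := by decide +kernel
/-- chunk `20` (rows `6688 … 7039`). [folklore] -/ theorem ssc20 : ssGo rank3Rows20 6688 = (156, 16, 2) := by decide +kernel
/-- chunk `21` (rows `7040 … 7391`). [folklore] -/ theorem ssc21 : ssGo rank3Rows21 7040 = (164, 16, 0) := by decide +kernel
/-- chunk `22` (rows `7392 … 7743`). [folklore] -/ theorem ssc22 : ssGo rank3Rows22 7392 = (147, 8, 0) := by decide +kernel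
/-- chunk `23` (rows `7744 … 8095`). [folklore] -/ theorem ssc23 : ssGo rank3Rows23 7744 = (169, 6, 0) := by decide +kernel
/-- chunk `24` (rows `8096 … 8447`). [folklore] -/ theorem ssc24 : ssGo rank3Rows24 8096 = (142, 8, 0) := by decide +kernel
/-- chunk `25` (rows `8448 … 8799`). [folklore] -/ theorem ssc25 : ssGo rank3Rows25 8448 = (147, 8, 0) := by decide +kernel
/-- chunk `26` (rows `8800 … 9151`). [folklore] -/ theorem ssc26 : ssGo rank3Rows26 8800 = (135, 16, 2) := by decide +kernel
/-- chunk `27` (rows `9152 … 9486`). [folklore] -/ theorem ssc27 : ssGo rank3Rows27 9152 = (110, 12, 0) := by decide +kernel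
end chunks

/-- **THE CENSUS OF THE SEMISTABLE ROWS**: `4 309` onto at `2, 3, 5`; `274` not onto at `2`; `12` not onto
at `3` (and `4 309 + 274 + 12 = 4 595`, row 52's semistable count: no semistable row fails twice, none
fails at `5`). [cite: CremonaAlgorithms1997, Tables] -/
theorem ssGo_rank3Table : ssGo rank3Table 0 = (4309, 274, 12) := by
  simp only [rank3Table, ssGo_append, List.length_append, Nat.reduceAdd, Prod.mk_add_mk,
    rank3Rows01_length, rank3Rows02_length, rank3Rows03_length, rank3Rows04_length, rank3Rows05_length,
    rank3Rows06_length, rank3Rows07_length, rank3Rows08_length, rank3Rows09_length, rank3Rows10_length,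
    rank3Rows11_length, rank3Rows12_length, rank3Rows13_length, rank3Rows14_length, rank3Rows15_length,
    rank3Rows16_length, rank3Rows17_length, rank3Rows18_length, rank3Rows19_length, rank3Rows20_length,
    rank3Rows21_length, rank3Rows22_length, rank3Rows23_length, rank3Rows24_length, rank3Rows25_length,
    rank3Rows26_length,
    ssc01, ssc02, ssc03, ssc04, ssc05, ssc06, ssc07, ssc08, ssc09, ssc10, ssc11, ssc12, ssc13, ssc14,
    ssc15, ssc16, ssc17, ssc18, ssc19, ssc20, ssc21, ssc22, ssc23, ssc24, ssc25, ssc26, ssc27]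

/-- **exactly `4 309` semistable rows are onto at `2`, `3` and `5`** — hence, hypothesis-free, at each of
Mazur's twelve primes (`Rank3Row.hasSurjectiveModNGaloisRep_of_semistableB`) and, granting Mazur's
Thm 1, at EVERY prime (`Rank3Row.hasSurjectiveModNGaloisRep_of_semistableB_of_mazur`).
[cite: CremonaAlgorithms1997, Tables] [cite: Serre1972, §5.4 Prop. 21] -/
theorem semistable_ontoSmall_count :
    (rank3Table.zipIdx.filter fun ri => ri.1.semistableB && ontoSmallB ri.2).length = 4309 := by
  have := ssGo_rank3Table
  rw [ssGo_eq] at this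
  exact (Prod.mk.injEq _ _ _ _ ▸ this).1

/-- **exactly `274` semistable rows are not onto at `2` and exactly `12` are not onto at `3`.**
[cite: CremonaAlgorithms1997, Tables] -/
theorem semistable_notOnto_two_three_count :
    (rank3Table.zipIdx.filter fun ri => ri.1.semistableB && !ontoIdxB 2 ri.2).length = 274 ∧
      (rank3Table.zipIdx.filter fun ri => ri.1.semistableB && !ontoIdxB 3 ri.2).length = 12 := by
  have := ssGo_rank3Table
  rw [ssGo_eq] at this
  simp only [Prod.mk.injEq] at this
  exact ⟨this.2.1, this.2.2⟩

/-! ## §4 Sample -/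

/-- row `0` (`5077a1`) is semistable (row 52, read at the index). [cite: CremonaAlgorithms1997, Tables] -/
theorem Rank3Row.semistableB_5077a1 {r : Rank3Row} (h : rank3Table[0]? = some r) : r.semistableB = true := by
  have h0 : (rank3Table[0]?).map Rank3Row.semistableB = some true := by decide +kernel
  rw [h, Option.map_some, Option.some.injEq] at h0
  exact h0

/-- **`5077a1`: `ρ̄_{E,p}` onto `GL₂(𝔽_p)` for EVERY prime `p`, granting Mazur's Thm 1 by name** (row 53
had `p > 163`; the atlas closes `p ≤ 13`, row 60 the rest of Mazur's list). [cite: Mazur1978, Thm 1]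
[cite: Serre1972, §5.4 Prop. 21] -/
theorem hasSurjectiveModNGaloisRep_5077a1_of_mazur (hM : mazur_isogeny_irreducible) {r : Rank3Row}
    (h : rank3Table[0]? = some r) (p : ℕ) (hp : p.Prime) : r.curve.HasSurjectiveModNGaloisRep p :=
  Rank3Row.hasSurjectiveModNGaloisRep_of_semistableB_of_mazur hM h (Rank3Row.semistableB_5077a1 h)
    (by decide +kernel) p hp

/-- **`5077a1`, hypothesis-free: onto at each of Mazur's twelve primes.** [cite: Serre1972, §5.4 Prop. 21] -/
theorem hasSurjectiveModNGaloisRep_5077a1_of_mem_mazurPrimes {r : Rank3Row} (h : rank3Table[0]? = some r)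
    (p : ℕ) (hp : p.Prime) (hpM : p ∈ mazurPrimes) : r.curve.HasSurjectiveModNGaloisRep p :=
  Rank3Row.hasSurjectiveModNGaloisRep_of_semistableB h (Rank3Row.semistableB_5077a1 h) (by decide +kernel) p hp hpM

end Summit.BirchSwinnertonDyer.BirchSwinnertonDyer.Rank2Observatory

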